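import Literature.Probability.Percolation.KozmaNitzanLemma3iCluster
import HarnessLib

/-!
# `NoHeavyLowerTail` (stmt-CriticalPhenomena-4575) — the GLUED PIECE of the four-point pocket exchange is a theorem:
# `μ(B = {a}, b ↔ c) ≤ μ(B = {b, c})` whenever `q_a ≤ q_c`

Support file (prover seat `prim-ineq-gen-8`, gen 5; `--supports stmt-CriticalPhenomena-4575`; memo
`run/shared/lean/prim/prim-ineq-gen-8/FINDING-Z32-STRUCTURE.md` §3).  No definitions, no named facts, no sorries.

`μ = prodBernoulli w` on `Fin n`, observer `o`, vertices `a, b, c`, `q_v = μ(o ↔ v)`, pocket `B = C_o ∩ {a,b,c}`.  The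
four-point pocket exchange `μ(B = {a}) ≤ μ(B = {b,c})` (assembly-2's (POCKET)/(POCKET-½), carrying the glued half of
the `|A| = 5` one-cut rung) splits the atom `{B = {a}}` according to whether `b ↔ c`:
`μ(B = {a}) = μ(B = {a}, b ↔ c) + μ(B = {a}, b ↮ c)`.  The FIRST part is dominated by `μ(B = {b,c})` on every
finite weighted graph as soon as `q_a ≤ q_c` — with no regime hypothesis — by Kozma–Nitzan's Lemma 3(i)
(`KozmaNitzan2024_lemma3_i_cluster_conn`, from the tree's BHK 2006 Thm 1.3/1.4) applied to the monotone cluster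
property "`o ∈ C(·)`" and the increasing event `{c ↔ b}` read on `C_c`:
`μ(o ↔ a, c ↔ b) ≤ μ(o ↔ c, c ↔ b)`; removing the common part `{o ↔ a, o ↔ b, o ↔ c}` of both sides leaves

* `OneCutFive.pocketExchange_glued_of_le` — **`q_a ≤ q_c` ⟹ `μ{o↔a, o↮b, o↮c, b↔c} ≤ μ{o↮a, o↔b, o↔c}`.**

This is exact on the tight family of the exchange (`b, c` glued, `q_a = q_{bc}`), where `{B={a}} = {B={a}, b↔c}`.
What remains OPEN of the exchange is the complementary piece `μ{B = {a}, b ↮ c} ≤ μ(B={b,c}) − μ{B={a}, b ↔ c}`,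
which needs the regime (it is false for `q` small: the `½`-star).
HONEST LABEL: toward `|A| = 5` of the one-arm near-critical percolation programme (crux 4575); the full exchange is OPEN.
-/

noncomputable section

namespace Summit.CriticalPhenomena.PercolationContinuityZ3.Theorems

open MeasureTheory Set Literature.Probability.LatticeModels Literature.Probability.Percolation
open scoped Classical

namespace OneCutFive

variable {n : ℕ}

/-- **The glued piece of the pocket exchange.**  If `μ(o ↔ a) ≤ μ(o ↔ c)` then
`μ{o ↔ a, o ↮ b, o ↮ c, b ↔ c} ≤ μ{o ↮ a, o ↔ b, o ↔ c}`: the part of the atom `{B = {a}}` on which `b` and `c` are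
joined is at most the atom `{B = {b,c}}`.  (Kozma–Nitzan Lemma 3(i) with the cluster property `o ∈ C(·)` and
`Q = {c ↔ b}`, minus the common event `{o ↔ a, o ↔ b, o ↔ c}`.)
[cite: KozmaNitzan2024, Lemma 3(i) (pp. 6–7)] -/
theorem pocketExchange_glued_of_le (w : Sym2 (Fin n) → unitInterval) (o a b c : Fin n)
    (hac : (prodBernoulli w).real (openConn o a) ≤ (prodBernoulli w).real (openConn o c)) :
    (prodBernoulli w).real {ω : BondConfig (Fin n) |
        ω ∈ openConn o a ∧ ω ∉ openConn o b ∧ ω ∉ openConn o c ∧ ω ∈ openConn b c} ≤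
      (prodBernoulli w).real {ω : BondConfig (Fin n) |
        ω ∉ openConn o a ∧ ω ∈ openConn o b ∧ ω ∈ openConn o c} := by
  set μ := prodBernoulli w with hμ
  have hm : ∀ S : Set (BondConfig (Fin n)), MeasurableSet S := fun S => (Set.toFinite S).measurableSet
  -- Lemma 3(i): `μ(o ∈ C(a), c ↔ b) ≤ μ(o ∈ C(c), c ↔ b)`
  have hmono : ∀ S T : Set (Fin n), S ⊆ T → o ∈ S → o ∈ T := fun S T hST ho => hST ho
  have hPa : {ω : BondConfig (Fin n) | o ∈ openCluster ω a} = openConn o a := by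
    ext ω; exact ⟨fun h => SimpleGraph.Reachable.symm h, fun h => SimpleGraph.Reachable.symm h⟩
  have hPc : {ω : BondConfig (Fin n) | o ∈ openCluster ω c} = openConn o c := by
    ext ω; exact ⟨fun h => SimpleGraph.Reachable.symm h, fun h => SimpleGraph.Reachable.symm h⟩
  have hQ : {ω : BondConfig (Fin n) | ∃ u ∈ ({b} : Set (Fin n)), (openGraph ω).Reachable c u} = openConn b c := by
    ext ω
    simp only [mem_setOf_eq, mem_singleton_iff, exists_eq_left]
    exact ⟨fun h => SimpleGraph.Reachable.symm h, fun h => SimpleGraph.Reachable.symm h⟩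
  have key := KozmaNitzan2024_lemma3_i_cluster_conn w a c (fun S => o ∈ S) hmono ({b} : Set (Fin n))
    (by rw [hPa, hPc]; exact hac)
  rw [hPa, hPc, hQ] at key
  -- split both sides off their common part `{o ↔ a, o ↔ b, o ↔ c}`
  set X₁ : Set (BondConfig (Fin n)) := openConn o a ∩ openConn b c with hX₁
  set X₂ : Set (BondConfig (Fin n)) := openConn o c ∩ openConn b c with hX₂
  have h1 := measureReal_inter_add_sdiff (μ := μ) (s := X₁) (hm (openConn o c))
  have h2 := measureReal_inter_add_sdiff (μ := μ) (s := X₂) (hm (openConn o a))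
  have hcommon : X₁ ∩ openConn o c = X₂ ∩ openConn o a := by
    ext ω
    simp only [hX₁, hX₂, mem_inter_iff]
    tauto
  have hleft : X₁ \ openConn o c = {ω : BondConfig (Fin n) |
      ω ∈ openConn o a ∧ ω ∉ openConn o b ∧ ω ∉ openConn o c ∧ ω ∈ openConn b c} := by
    ext ω
    simp only [hX₁, mem_sdiff, mem_inter_iff, mem_setOf_eq]
    constructor
    · rintro ⟨⟨hoa, hbc⟩, hoc⟩
      refine ⟨hoa, fun hob => hoc ?_, hoc, hbc⟩
      exact (show (openGraph ω).Reachable o b from hob).trans (show (openGraph ω).Reachable b c from hbc)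
    · rintro ⟨hoa, -, hoc, hbc⟩
      exact ⟨⟨hoa, hbc⟩, hoc⟩
  have hright : X₂ \ openConn o a = {ω : BondConfig (Fin n) |
      ω ∉ openConn o a ∧ ω ∈ openConn o b ∧ ω ∈ openConn o c} := by
    ext ω
    simp only [hX₂, mem_sdiff, mem_inter_iff, mem_setOf_eq]
    constructor
    · rintro ⟨⟨hoc, hbc⟩, hoa⟩
      exact ⟨hoa, (show (openGraph ω).Reachable o c from hoc).trans
        (show (openGraph ω).Reachable b c from hbc).symm, hoc⟩
    · rintro ⟨hoa, hob, hoc⟩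
      exact ⟨⟨hoc, (show (openGraph ω).Reachable o b from hob).symm.trans
        (show (openGraph ω).Reachable o c from hoc)⟩, hoa⟩
  rw [← hleft, ← hright]
  have hk : μ.real X₁ ≤ μ.real X₂ := key
  rw [hcommon] at h1
  linarith

end OneCutFive

end Summit.CriticalPhenomena.PercolationContinuityZ3.Theorems

end
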